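import Literature.Analysis.Complex.UnitDiscAutomorphisms
import Literature.Analysis.Complex.UnitDiscHyperbolic
import HarnessLib

/-!
# Hyperbolic geometry of the unit disc, II: `Aut(𝔻)` acts by isometries; half-turns

Topic `Literature/Analysis/Complex`.  Continuation of `UnitDiscHyperbolic.lean` (formulas) with
the statements that involve the automorphism group `Aut(𝔻)` of `UnitDiscAutomorphisms.lean`
(Beardon, *The Geometry of Discrete Groups*, §7.4, §7.33; Conway VI.2.5):

* `IsDiscAut.discCosh_eq` — every holomorphic automorphism of the disc preserves `cosh ρ`
  (`Aut(𝔻)` acts by hyperbolic isometries);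
* `exists_isDiscAut_apply_eq_apply_eq` — two-point homogeneity: pairs at equal hyperbolic
  distance are congruent under `Aut(𝔻)`;
* `isDiscAut_discHalfTurn`, `IsDiscAut.eqOn_discHalfTurn` — the half-turn about `q` is an
  automorphism, and it is the unique involutive automorphism `≠ id` fixing `q`.

Proof-only over parts I and `UnitDiscAutomorphisms`; serves `UnitDiscAutNormalizer.lean`.
-/

noncomputable section

open Set Filter Metric Function
open _root_.Complex
open scoped ComplexConjugate Topology

namespace Literature.Analysis.Complex

/-- The automorphisms `z ↦ c·φ_a(z)` preserve `cosh ρ`. [cite: Beardon1983, Thm. 7.2.1] -/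
theorem discCosh_discRot {c a z w : ℂ} (hc : ‖c‖ = 1) (ha : ‖a‖ < 1) (hz : ‖z‖ < 1) (hw : ‖w‖ < 1) :
    discCosh (discRot c a z) (discRot c a w) = discCosh z w := by
  rw [discRot, discRot, discCosh_mul hc, discCosh_discMobius ha hz hw]

/-- **`Aut(𝔻)` acts by hyperbolic isometries**: every holomorphic automorphism of the disc
preserves `cosh ρ` (Beardon §7.4 with Conway VI.2.5). [cite: Beardon1983, Thm. 7.4.1] -/
theorem IsDiscAut.discCosh_eq {f : ℂ → ℂ} (hf : IsDiscAut f) {z w : ℂ} (hz : ‖z‖ < 1)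
    (hw : ‖w‖ < 1) : discCosh (f z) (f w) = discCosh z w := by
  obtain ⟨c, a, hc, ha, -, hfe⟩ := hf.exists_eq_discRot
  rw [hfe (mem_ball_zero_iff.2 hz), hfe (mem_ball_zero_iff.2 hw), discCosh_discRot hc ha hz hw]

/-- An automorphism fixing `0` preserves `‖·‖` (restated through `cosh ρ(0,·)`).
[cite: Conway1978, Ch. VI Thm. 2.5] -/
theorem IsDiscAut.norm_eq {f : ℂ → ℂ} (hf : IsDiscAut f) (h0 : f 0 = 0) {z : ℂ} (hz : ‖z‖ < 1) :
    ‖f z‖ = ‖z‖ :=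
  hf.norm_eq_of_map_zero h0 hz

/-! ### Two-point homogeneity -/

/-- **Two-point homogeneity of the hyperbolic disc**: pairs of points at the same hyperbolic
distance are congruent under `Aut(𝔻)` (Beardon §7.4). [cite: Beardon1983, Thm. 7.4.1] -/
theorem exists_isDiscAut_apply_eq_apply_eq {z w z' w' : ℂ} (hz : ‖z‖ < 1) (hw : ‖w‖ < 1)
    (hz' : ‖z'‖ < 1) (hw' : ‖w'‖ < 1) (h : discCosh z w = discCosh z' w') :
    ∃ f : ℂ → ℂ, IsDiscAut f ∧ f z = z' ∧ f w = w' := by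
  -- move `z`, `z'` to the origin
  set w₁ := discMobius z w with hw₁
  set w₁' := discMobius z' w' with hw₁'
  have hw₁n : ‖w₁‖ < 1 := norm_discMobius_lt_one hz hw
  have hw₁'n : ‖w₁'‖ < 1 := norm_discMobius_lt_one hz' hw'
  have hcosh : discCosh 0 w₁ = discCosh 0 w₁' := by
    have e1 := discCosh_discMobius (a := z) hz hz hw
    have e2 := discCosh_discMobius (a := z') hz' hz' hw'
    rw [discMobius_self] at e1 e2
    rw [e1, e2, h]
  have hnorm : ‖w₁‖ = ‖w₁'‖ := norm_eq_norm_of_discCosh_zero_eq hw₁n hw₁'n hcosh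
  -- a rotation taking `w₁` to `w₁'`
  obtain ⟨c, hc, hcw⟩ : ∃ c : ℂ, ‖c‖ = 1 ∧ c * w₁ = w₁' := by
    by_cases h0 : w₁ = 0
    · refine ⟨1, norm_one, ?_⟩
      have : w₁' = 0 := by rw [← norm_eq_zero, ← hnorm, h0, norm_zero]
      rw [h0, this, mul_zero]
    · refine ⟨w₁' / w₁, ?_, div_mul_cancel₀ _ h0⟩
      rw [norm_div, ← hnorm, div_self (norm_ne_zero_iff.2 h0)]
  have hz'neg : ‖-z'‖ < 1 := by rwa [norm_neg]
  refine ⟨discMobius (-z') ∘ (fun u => c * u) ∘ discMobius z,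
    (isDiscAut_discMobius hz'neg).comp ((isDiscAut_mul hc).comp (isDiscAut_discMobius hz)), ?_, ?_⟩
  · simp only [comp_apply, discMobius_self, mul_zero, discMobius_zero, neg_neg]
  · simp only [comp_apply]
    rw [← hw₁, hcw, hw₁', discMobius_neg_discMobius hz' hw'.le]

/-! ### Half-turns and `Aut(𝔻)` -/

/-- The half-turn about `q ∈ 𝔻` is an automorphism of the disc. [cite: Beardon1983, §7.33] -/
theorem isDiscAut_discHalfTurn {q : ℂ} (hq : ‖q‖ < 1) : IsDiscAut (discHalfTurn q) := by
  rw [discHalfTurn_eq_comp]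
  have hq' : ‖-q‖ < 1 := by rwa [norm_neg]
  exact (isDiscAut_discMobius hq').comp ((isDiscAut_mul (by simp)).comp (isDiscAut_discMobius hq))

/-- **Uniqueness of the half-turn**: an involutive automorphism of the disc fixing `q` and not
the identity is the half-turn `σ_q` (conjugate to `z ↦ -z` by Conway VI.2.5).
[cite: Beardon1983, §7.33] -/
theorem IsDiscAut.eqOn_discHalfTurn {g : ℂ → ℂ} (hg : IsDiscAut g) {q : ℂ} (hq : ‖q‖ < 1)
    (hgq : g q = q) (hinv : ∀ z ∈ ball (0 : ℂ) 1, g (g z) = z) (hne : ¬ EqOn g id (ball 0 1)) :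
    EqOn g (discHalfTurn q) (ball 0 1) := by
  have hq' : ‖-q‖ < 1 := by rwa [norm_neg]
  -- conjugate to the origin
  set G := discMobius q ∘ g ∘ discMobius (-q) with hG
  have hGaut : IsDiscAut G := (isDiscAut_discMobius hq).comp (hg.comp (isDiscAut_discMobius hq'))
  have hG0 : G 0 = 0 := by simp [hG, hgq]
  have hGinv : ∀ z ∈ ball (0 : ℂ) 1, G (G z) = z := by
    intro z hz
    have hz' : ‖z‖ < 1 := mem_ball_zero_iff.1 hz
    have hm : discMobius (-q) z ∈ ball (0 : ℂ) 1 := mapsTo_discMobius hq' hz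
    have hgm : g (discMobius (-q) z) ∈ ball (0 : ℂ) 1 := hg.mapsTo hm
    simp only [hG, comp_apply]
    rw [show discMobius (-q) (discMobius q (g (discMobius (-q) z))) = g (discMobius (-q) z) by
      simpa using discMobius_neg_discMobius hq (mem_ball_zero_iff.1 hgm).le,
      hinv _ hm]
    simpa using discMobius_neg_discMobius hq' hz'.le
  have hGne : ¬ EqOn G id (ball 0 1) := by
    intro hGid
    apply hne
    intro z hz
    have hz' : ‖z‖ < 1 := mem_ball_zero_iff.1 hz
    have hm : discMobius q z ∈ ball (0 : ℂ) 1 := mapsTo_discMobius hq hz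
    have h := hGid hm
    simp only [hG, comp_apply, id] at h
    rw [show discMobius (-q) (discMobius q z) = z from discMobius_neg_discMobius hq hz'.le] at h
    -- `φ_q (g z) = φ_q z`, and `φ_q` is injective on the disc
    exact (isDiscAut_discMobius hq).injOn (hg.mapsTo hz) hz h
  have hGneg := hGaut.eq_neg_of_involutive hG0 hGinv hGne
  intro z hz
  have hz' : ‖z‖ < 1 := mem_ball_zero_iff.1 hz
  have hm : discMobius q z ∈ ball (0 : ℂ) 1 := mapsTo_discMobius hq hz
  have h := hGneg hm
  simp only [hG, comp_apply] at h
  rw [show discMobius (-q) (discMobius q z) = z from discMobius_neg_discMobius hq hz'.le] at h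
  -- `φ_q (g z) = -φ_q z`; apply `φ_{-q}`
  have h2 := congrArg (discMobius (-q)) h
  rwa [show discMobius (-q) (discMobius q (g z)) = g z by
    simpa using discMobius_neg_discMobius hq (mem_ball_zero_iff.1 (hg.mapsTo hz)).le] at h2

end Literature.Analysis.Complex
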